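import Summits.NavierStokesRegularity.NavierStokesRegularity.Theorems.CertifiedBlowupCertifiedBlowupAxisymBlowupEnstrophyRate
import Summits.NavierStokesRegularity.NavierStokesRegularity.Theorems.CertifiedBlowupCertifiedBlowupAxisymBlowupLerayRates
import HarnessLib

/-!
# Leray's lower bounds on the lifespan of every witness of the crux `CertifiedBlowupAxisymBlowup`

Theorems file landed `--supports stmt-NavierStokesRegularity-0727`, line `compact-amplification`
(continuation lead c3; registered stub `lifespan_lower_bound_of_isMaximalSmoothSolution`). A witness
of the crux is a viscosity `ν > 0`, a time `T > 0` and a maximal smooth solution `(u, p)` of the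
unforced Navier–Stokes system of lifespan `T`, Leray–Hopf on `[0, T]` from its rapidly decaying
axisymmetric datum `u 0`. Leray 1934, §19 (3.8) and §20 (3.12): a regular solution from a datum with
`V = max |u₀|` and `W² = ∫ |∇u₀|²` stays regular at least for a time `≥ A ν V⁻²` and `≥ A ν³ W⁻⁴`.
At the crux: the LIFESPAN of every witness obeys `T ≥ c ν³ / (∫|∇u(0)|²)²` and `T ≥ c ν / ‖u(0)‖²_∞`,
written in `[0, ∞]` as `c ν³ / T ≤ (∫|∇u(0)|²)²` and `c ν / T ≤ ‖u(0)‖²_{L^∞}` — the time-zero cases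
of the landed blow-up rates `enstrophy_rate_of_isMaximalSmoothSolution` (wave 2) and
`leray_rates_of_isMaximalSmoothSolution` (wave 1), squared. These are the sanity bounds every
certified axisymmetric blow-up candidate `(ν, T, u₀)` must pass (route CertifiedBlowup), with one
absolute constant `c`.

No new definitions, no named-fact hypotheses, no `sorry`.

## References

* J. Leray, *Sur le mouvement d'un liquide visqueux emplissant l'espace*, Acta Math. 63 (1934),
  §19 (3.8) p. 224 and §20 (3.12) p. 225. [Leray1934]
* J. C. Robinson, J. L. Rodrigo, W. Sadowski, *The Three-Dimensional Navier–Stokes Equations*,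
  CUP 2016, Cor. 6.9, Lemma 6.14, Thm. 6.22. [RobinsonRodrigoSadowski2016]
-/

-- the summit and its single problem share the name (D-0017 nested layout)
set_option linter.dupNamespace false

noncomputable section

open MeasureTheory Set Function Filter Topology Metric
open scoped ENNReal NNReal

namespace Summit.NavierStokesRegularity.NavierStokesRegularity.Theorems.CertifiedBlowupAxisymBlowup.CompactAmplification

open Literature.Analysis.FluidPDE

/-- Squaring a rate: if `ofReal (a / √T) ≤ X` with `0 ≤ a` and `0 < T` then `ofReal (a² / T) ≤ X²`.
[folklore] -/
private theorem ofReal_sq_div_le_sq {a T : ℝ} (ha : 0 ≤ a) (hT : 0 < T) {X : ℝ≥0∞}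
    (h : ENNReal.ofReal (a / Real.sqrt T) ≤ X) : ENNReal.ofReal (a ^ 2 / T) ≤ X ^ 2 := by
  have h2 : ENNReal.ofReal (a / Real.sqrt T) ^ 2 ≤ X ^ 2 := pow_le_pow_left' h 2
  have e : ENNReal.ofReal (a / Real.sqrt T) ^ 2 = ENNReal.ofReal (a ^ 2 / T) := by
    rw [← ENNReal.ofReal_pow (div_nonneg ha (Real.sqrt_nonneg T)), div_pow, Real.sq_sqrt hT.le]
  rwa [e] at h2

/-- **Leray's lower bounds on the lifespan of every witness** (registered stub of
stmt-NavierStokesRegularity-0727; Leray 1934 §19 (3.8), §20 (3.12)): there is an absolute `c > 0`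
such that every maximal Leray–Hopf classical solution `(u, p)` of viscosity `ν > 0` and finite
lifespan `T` from a rapidly decaying axisymmetric datum satisfies `c ν³ / T ≤ (∫ |∇u(0)|²)²`
(Frobenius enstrophy of the datum, in `[0, ∞]`) and `c ν / T ≤ ‖u(0)‖²_{L^∞}`; i.e. the lifespan is
at least `c ν³ / (∫|∇u₀|²)²` and at least `c ν / ‖u₀‖²_∞`. Both are the `t = 0` instances of the
landed blow-up rates (`enstrophy_rate_of_isMaximalSmoothSolution`,
`leray_rates_of_isMaximalSmoothSolution`), squared, with `c = min (c₁², c₂²)`.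
[cite: Leray1934, §19 (3.8) p. 224 and §20 (3.12) p. 225] -/
theorem lifespan_lower_bound_of_isMaximalSmoothSolution : ∃ c : ℝ, 0 < c ∧ ∀ {ν T : ℝ} {u : ℝ → EuclideanSpace ℝ (Fin 3) → EuclideanSpace ℝ (Fin 3)} {p : ℝ → EuclideanSpace ℝ (Fin 3) → ℝ}, 0 < ν → 0 < T → IsMaximalSmoothSolution ν 0 u p T → IsLerayHopfOn T ν 0 (u 0) u → HasRapidSpatialDecay (u 0) → IsAxisymmetric (u 0) → ENNReal.ofReal (c * ν ^ 3 / T) ≤ (∫⁻ x, ENNReal.ofReal (frobeniusNormSq (fderiv ℝ (u 0) x))) ^ 2 ∧ ENNReal.ofReal (c * ν / T) ≤ eLpNorm (u 0) ⊤ volume ^ 2 := by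
  obtain ⟨c₁, hc₁, h₁⟩ := enstrophy_rate_of_isMaximalSmoothSolution
  obtain ⟨⟨c₂, hc₂, h₂⟩, -⟩ := leray_rates_of_isMaximalSmoothSolution
  refine ⟨min (c₁ ^ 2) (c₂ ^ 2), lt_min (pow_pos hc₁ 2) (pow_pos hc₂ 2),
    fun {ν T u p} hν hT hmax hLH hdec haxi => ⟨?_, ?_⟩⟩
  · -- enstrophy: `ofReal (c₁ ν^{3/2} / √T) ≤ ∫ frob(∇u 0)` at `t = 0`, squared
    have h0 := h₁ hν hT hmax hLH hdec haxi 0 ⟨le_rfl, hT⟩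
    rw [sub_zero] at h0
    have hsq := ofReal_sq_div_le_sq (by positivity) hT h0
    refine le_trans (ENNReal.ofReal_le_ofReal ?_) hsq
    have e : (c₁ * ν ^ (3 / 2 : ℝ)) ^ 2 = c₁ ^ 2 * ν ^ 3 := by
      rw [mul_pow, ← Real.rpow_natCast (ν ^ (3 / 2 : ℝ)) 2, ← Real.rpow_mul hν.le]
      norm_num
    rw [e]
    exact div_le_div_of_nonneg_right (mul_le_mul_of_nonneg_right (min_le_left _ _)
      (pow_nonneg hν.le 3)) hT.le
  · -- velocity: `ofReal (c₂ √ν / √T) ≤ ‖u 0‖_∞` at `t = 0`, squared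
    have h0 := (h₂ hν hT hmax hLH hdec haxi 0 ⟨le_rfl, hT⟩).1
    rw [sub_zero] at h0
    have hsq := ofReal_sq_div_le_sq (by positivity) hT h0
    refine le_trans (ENNReal.ofReal_le_ofReal ?_) hsq
    have e : (c₂ * Real.sqrt ν) ^ 2 = c₂ ^ 2 * ν := by
      rw [mul_pow, Real.sq_sqrt hν.le]
    rw [e]
    exact div_le_div_of_nonneg_right (mul_le_mul_of_nonneg_right (min_le_right _ _) hν.le) hT.le

end Summit.NavierStokesRegularity.NavierStokesRegularity.Theorems.CertifiedBlowupAxisymBlowup.CompactAmplification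

end
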